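import Summits.CriticalPhenomena.PercolationContinuityZ3.Theorems.PercNearOneGluingNoHeavyQuantSingleLowCellsA
import Summits.CriticalPhenomena.PercolationContinuityZ3.Theorems.PercNearOneGluingNoHeavyQuantSingleLowCellsB
import Summits.CriticalPhenomena.PercolationContinuityZ3.Theorems.PercNearOneGluingNoHeavyQuantReflectionGatesClosed
import Summits.CriticalPhenomena.PercolationContinuityZ3.Theorems.PercNearOneGluingNoHeavyQuantSixBlobs
import Summits.CriticalPhenomena.PercolationContinuityZ3.Theorems.PercNearOneGluingNoHeavyQuantSevenBlobs
import HarnessLib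

/-!
# QUANT lane R8, T-DEC: **CONJECTURE BLOB-AFL FOR EVERY GATE VECTOR OF WIDTH AT MOST 7** — `n ≤ 7` blobs of a common size with ARBITRARY
# gates `gᵢ ∈ [0,1]` are heavy at their average gate (prim-quant-census-2 gen 83, file 8)

builds on p205010 (kernel theorem, internal audit signed; external expert review pending)

Support file (`--supports stmt-CriticalPhenomena-4575`), QUANT lane census seat prim-quant-census-2 (gen 83); memo
`run/shared/lean/prim/quant/prim-quant-census-2-g83/HOEFFDING-G83.md`.  Theorems only, standard axioms, no sorries, no definitions.

Conjecture BLOB-AFL (`run/shared/lean/prim/quant/prim-quant-census-2-g80/TRIPLE-G80.md` §5: "`n` equal blobs with gates `g₁..g_n` are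
heavy-DEC at the AVERAGE gate `(Σgᵢ)/n`, target `k·Σgᵢ`" — the one new ingredient per width of the glued-identical-siblings SDEC scheme) was
kernel for arbitrary gate vectors up to width 4 only (`heavy_threeBlobs_gates`, `heavy_fourBlobs_gates`, census-2 g81: eleven capacity
certificates at width 4, the width-5 recipe left with five undecided six-atom certificates).  The HOEFFDING REDUCTION of this generation
(`heavy_blobLaw_of_onesEqualFamily`, `…QuantThreeValuedReduction`) replaces the per-width capacity analysis by the `(m, r)` cells
"`m` ones + `r` equal gates `g`": `g ≥ 1/2` reflection (`heavy_onesEqual_of_half_le_floor`), `m = 0` equal gates (`heavy_blobLaw_of_mean_le_two`,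
`heavy_blobLaw_replicate_five/six/seven`), and the single-low cells `heavy_c13`, `heavy_c14`, `heavy_c15a/b`, `heavy_c16a/b/c`, `heavy_c25`
(`…QuantSingleLowCellsA/B`; `2m < r`, `m + r ≤ 7` leaves exactly `(m,r) ∈ {(1,3),(1,4),(1,5),(1,6),(2,5)}`).
* **`heavy_blobLaw_gates_width_le_seven`** — for EVERY gate list `G ⊂ [0,1]` with `|G| ≤ 7` and every blob size `k ≥ 1`, `blobLaw (G.map (k,·))`
  is heavy at floor `ΣG/|G|` and target `k·ΣG` on `{0..|G|·k}`; `decAtT_blobLaw_gates_width_le_seven` — hence DEC at every layer.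
  Supersedes `heavy_threeBlobs_gates` / `heavy_fourBlobs_gates` (widths 3, 4) and extends BLOB-AFL for arbitrary gates to widths 5, 6, 7.

HONEST STATUS.  Width `≥ 8` for arbitrary gates OPEN (width 8 needs the two-low cell `(1,7)`, `3/7 < g < 1/2`, and `(2,6)`; equal gates are
kernel through width 8); conjecture C, `SiblingStep`, `FarTreeRow`, `GluedLemmaW`, `GluedDominatedMass` OPEN; RATE class (log\*) / honest sentence
of `run/shared/lean/prim/quant/README.md` unchanged.  [this work].  Nothing here is cited as a published result.  The gluing rows served
[cite: KozmaNitzan2024, Conjecture 3 (p. 15)]; product measure [cite: Grimmett1999, §1.3 p. 10].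
-/

noncomputable section

open scoped BigOperators

namespace Summit.CriticalPhenomena.PercolationContinuityZ3.Theorems
namespace Quant

open Finset

/-- the two-point law `{lo, hi; g}` (as in `…QuantLawDEC`) -/
local notation3 "TP[" lo ", " hi ", " g ", " h "]" =>
  (g : ℝ) * (if (h : ℕ) = (hi : ℕ) then (1 : ℝ) else 0) + (1 - (g : ℝ)) * (if (h : ℕ) = (lo : ℕ) then (1 : ℝ) else 0)

/-- a HEAVY decomposition of the law `μ` on `{0..M}` at floor `x`, target `T` (the inline `∃` consumed by `decAtT_of_heavy`) -/
local notation3 "HEAVY[" x ", " T ", " M ", " μ "]" =>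
  ∃ (ι : Type) (_ : Fintype ι) (lam γ : ι → ℝ) (lo hi : ι → ℕ),
    (∀ i, 0 ≤ lam i) ∧ (∑ i, lam i = 1) ∧ (∀ i, 0 ≤ γ i ∧ γ i ≤ 1) ∧ (∀ i, lo i ≤ hi i) ∧ (∀ i, hi i ≤ (M : ℕ)) ∧
    (∀ h, (μ : ℕ → ℝ) h = ∑ i, lam i * TP[lo i, hi i, γ i, h]) ∧
    (∀ i, 0 < lam i → (x : ℝ) ≤ γ i ∧ (T : ℝ) ≤ 2 * (lo i : ℝ) + ((hi i : ℝ) - lo i) * γ i)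

/-- the blob list of a gate list at the common blob size `k` -/
local notation3 "BL[" k ", " G "]" => LawDec.blobLaw (List.map (fun g : ℝ => ((k : ℕ), g)) G)

namespace LawDec

/-- the equal-gates cells `m = 0`, `r ≤ 7`, `g < 1/2`, at any floor `x ≤ g`. [this work] -/
theorem heavy_replicate_le_seven_floor (k r : ℕ) (hk : 0 < k) {g x : ℝ} (hg0 : 0 < g) (hg1 : g < 1 / 2) (hr : 0 < r) (hr7 : r ≤ 7)
    (hx : x ≤ g) : HEAVY[x, (k : ℝ) * (r * g), r * k, blobLaw (List.replicate r (k, g))] := by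
  have hk' : (0 : ℝ) < k := by exact_mod_cast hk
  have hg1' : g < 1 := by linarith
  by_cases hrg : (r : ℝ) * g ≤ 2
  · -- zero-only-low regime
    have hl : ∀ p ∈ List.replicate r (k, g), p.1 = k ∧ 0 ≤ p.2 ∧ p.2 ≤ 1 := fun p hp => by
      rw [List.eq_of_mem_replicate hp]; exact ⟨rfl, hg0.le, hg1'.le⟩
    have htop : blobTop (List.replicate r (k, g)) = r * k := blobTop_replicate r k g
    have hmean : blobMean (List.replicate r (k, g)) = (r : ℝ) * k * g := by rw [blobMean_replicate]
    have hm0 : 0 < blobMean (List.replicate r (k, g)) := by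
      rw [hmean]; have : (0 : ℝ) < r := by exact_mod_cast hr
      positivity
    have hm2 : blobMean (List.replicate r (k, g)) ≤ 2 * k := by rw [hmean]; nlinarith
    have key := heavy_blobLaw_of_mean_le_two k _ hl hm0 hm2
    rw [hmean, htop] at key
    have e1 : (r : ℝ) * k * g / ((r * k : ℕ) : ℝ) = g := by
      have : (0 : ℝ) < r := by exact_mod_cast hr
      push_cast; field_simp
    have e2 : (r : ℝ) * k * g = (k : ℝ) * (r * g) := by ring
    rw [e1, e2] at key
    exact heavy_mono _ _ _ _ _ _ hx le_rfl key
  · -- `r g > 2`, `g < 1/2`: `r ≥ 5`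
    have hr5 : 5 ≤ r := by
      by_contra h
      have : (r : ℝ) ≤ 4 := by exact_mod_cast (by omega : r ≤ 4)
      nlinarith
    interval_cases r
    · have key := heavy_blobLaw_replicate_five k hk hg0 hg1'
      rw [show (5 : ℝ) * k * g = (k : ℝ) * ((5 : ℕ) * g) by push_cast; ring] at key
      exact heavy_mono _ _ _ _ _ _ hx le_rfl key
    · have key := heavy_blobLaw_replicate_six k hk hg0 hg1'
      rw [show (6 : ℝ) * k * g = (k : ℝ) * ((6 : ℕ) * g) by push_cast; ring] at key
      exact heavy_mono _ _ _ _ _ _ hx le_rfl key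
    · have key := heavy_blobLaw_replicate_seven k hk hg0 hg1'
      rw [show (7 : ℝ) * k * g = (k : ℝ) * ((7 : ℕ) * g) by push_cast; ring] at key
      exact heavy_mono _ _ _ _ _ _ hx le_rfl key

/-- the single-low cells `m ≥ 1`, `g < 1/2`, `m + r ≤ 7`, at any floor `x ≤ (m + r g)/(m + r)`, in shifted form. [this work] -/
theorem heavy_singleLow_le_seven_floor (k m r : ℕ) (hk : 0 < k) {g x : ℝ} (hg1 : g < 1 / 2) (hm : 0 < m) (hmr : m + r ≤ 7)
    (hlow : (m : ℝ) < r * g) (hx : x ≤ ((m : ℝ) + r * g) / ((m : ℝ) + r)) :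
    HEAVY[x, (k : ℝ) * (r * g - m), r * k, blobLaw (List.replicate r (k, g))] := by
  have h2m : 2 * m < r := by
    have hr0 : (0 : ℝ) ≤ r := Nat.cast_nonneg r
    have : (2 * m : ℝ) < r := by nlinarith
    exact_mod_cast this
  have hcases : (m = 1 ∧ r = 3) ∨ (m = 1 ∧ r = 4) ∨ (m = 1 ∧ r = 5) ∨ (m = 1 ∧ r = 6) ∨ (m = 2 ∧ r = 5) := by omega
  rcases hcases with ⟨rfl, rfl⟩ | ⟨rfl, rfl⟩ | ⟨rfl, rfl⟩ | ⟨rfl, rfl⟩ | ⟨rfl, rfl⟩ <;> push_cast at hlow hx ⊢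
  · have hx' : x ≤ ((1 : ℝ) + 3 * g) / 4 := by norm_num at hx; linarith
    exact heavy_mono _ _ _ _ _ _ hx' le_rfl (heavy_c13 k hk (by linarith) hg1)
  · have hx' : x ≤ ((1 : ℝ) + 4 * g) / 5 := by norm_num at hx; linarith
    exact heavy_mono _ _ _ _ _ _ hx' le_rfl (heavy_c14 k hk (by linarith) hg1)
  · have hx' : x ≤ ((1 : ℝ) + 5 * g) / 6 := by norm_num at hx; linarith
    rcases le_or_gt g (2 / 5) with h25 | h25
    · exact heavy_mono _ _ _ _ _ _ hx' le_rfl (heavy_c15a k hk (by linarith) h25)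
    · exact heavy_mono _ _ _ _ _ _ hx' le_rfl (heavy_c15b k hk h25 hg1)
  · have hx' : x ≤ ((1 : ℝ) + 6 * g) / 7 := by norm_num at hx; linarith
    rcases le_or_gt g (3 / 10) with h3 | h3
    · exact heavy_mono _ _ _ _ _ _ hx' le_rfl (heavy_c16a k hk (by linarith) h3)
    · rcases le_or_gt g (5 / 12) with h5 | h5
      · exact heavy_mono _ _ _ _ _ _ hx' le_rfl (heavy_c16b k hk h3 h5)
      · exact heavy_mono _ _ _ _ _ _ hx' le_rfl (heavy_c16c k hk h5 hg1)
  · have hx' : x ≤ ((2 : ℝ) + 5 * g) / 7 := by norm_num at hx; linarith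
    exact heavy_mono _ _ _ _ _ _ hx' le_rfl (heavy_c25 k hk (by linarith) hg1)

/-- **CONJECTURE BLOB-AFL FOR EVERY GATE VECTOR OF WIDTH AT MOST 7.**  For every gate list `G ⊂ [0,1]` with `|G| ≤ 7` and every blob size
`k ≥ 1`, the law `blobLaw (G.map (k,·))` of `|G|` blobs of size `k` with gates `G` is heavy at floor `ΣG/|G|` (the AVERAGE gate) and target
`k·ΣG`. [this work] -/
theorem heavy_blobLaw_gates_width_le_seven (k : ℕ) (hk : 0 < k) (G : List ℝ) (hG : ∀ g ∈ G, 0 ≤ g ∧ g ≤ 1) (hn : G.length ≤ 7) :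
    HEAVY[G.sum / G.length, (k : ℝ) * G.sum, G.length * k, BL[k, G]] := by
  refine heavy_blobLaw_of_onesEqualFamily k G hG fun m r g hmr hg0 hg1 hS hlow => ?_
  have hr : 0 < r := by
    rcases Nat.eq_zero_or_pos r with h0 | h0
    · exfalso; subst h0
      simp only [Nat.cast_zero, zero_mul] at hlow
      linarith [Nat.cast_nonneg (α := ℝ) m]
    · exact h0
  have hr' : (0 : ℝ) < r := by exact_mod_cast hr
  have hmr' : ((m : ℝ) + r) ≤ G.length := by exact_mod_cast hmr
  have hmrpos : (0 : ℝ) < (m : ℝ) + r := by positivity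
  have hSnn : 0 ≤ (m : ℝ) + r * g := by positivity
  have hx : G.sum / G.length ≤ ((m : ℝ) + r * g) / ((m : ℝ) + r) := by
    rw [← hS]; exact div_le_div_of_nonneg_left hSnn hmrpos hmr'
  rcases le_or_gt (1 / 2 : ℝ) g with hhalf | hhalf
  · -- reflection cells
    have key := heavy_onesEqual_of_half_le_floor k m r hhalf hg1 hr hx
    rw [hS] at key
    exact key
  rcases Nat.eq_zero_or_pos m with hm0 | hmpos
  · -- equal gates
    subst hm0
    simp only [Nat.cast_zero, zero_add] at hS hx
    have hxg : G.sum / G.length ≤ g := by rwa [mul_div_cancel_left₀ g hr'.ne'] at hx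
    have key := heavy_replicate_le_seven_floor k r hk hg0 hhalf hr (by omega) hxg
    rw [hS] at key
    simpa only [List.replicate_zero, List.nil_append, List.map_replicate, zero_add] using key
  · -- single-low cells, via the shifted form
    have hcell := heavy_singleLow_le_seven_floor k m r hk hhalf hmpos (hmr.trans hn) hlow hx
    have key := heavy_onesEqual_of_shifted k m r g _ hcell
    rw [hS] at key
    exact key

/-- **hence DEC at every layer**, for every gate vector of width at most `7`. [this work] -/
theorem decAtT_blobLaw_gates_width_le_seven (k : ℕ) (hk : 0 < k) (G : List ℝ) (hG : ∀ g ∈ G, 0 ≤ g ∧ g ≤ 1) (hn : G.length ≤ 7)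
    (j : ℕ) : DECAtT (G.sum / G.length) ((k : ℝ) * G.sum) j (G.length * k) (blobLaw (List.map (fun g : ℝ => (k, g)) G)) :=
  decAtT_of_heavy _ _ _ _ (heavy_blobLaw_gates_width_le_seven k hk G hG hn) j

end LawDec
end Quant
end Summit.CriticalPhenomena.PercolationContinuityZ3.Theorems
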